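import Mathlib
import Literature.NumberTheory.Irrationality.Fischler2002.LFinitenessLowerProofs
import Literature.NumberTheory.Irrationality.Fischler2002.Theoreme21Proofs
import HarnessLib

/-!
# The finiteness criterion for Fischler's Sorokin-type family `𝓛(P)` — III: the criterion, and the note's erratum

Topic `Literature/NumberTheory/Irrationality/Fischler2002`; proofs-only companion of `BeukersSorokinChangeOfVariables.lean`
(the §2 file: `L`, `K`, `paramMap`, and the PROVED `theoreme21_holds`); third of three files (I: `LFinitenessUpperProofs.lean`,
II: `LFinitenessLowerProofs.lean`). Source: S. Fischler, « Formes linéaires en polyzêtas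
et intégrales multiples », C. R. Acad. Sci. Paris Sér. I **335** (2002) 1–4 = arXiv:math/0202064 [Fischler2002Polyzetas],
§2 p. 3 (read on the page, `paper:arxiv-math_0202064` p. 3): "`𝓛(P) = ∫_{[0,1]^n} ∏_{k=1}^n X_k^{A_k}(1−X_k)^{B_k} /
∏_{k=2}^n (1 − X₁X₂…X_k)^{C_k+1} dX₁…dX_n`. Cette intégrale est finie [si et seulement si] on a
`Σ_{k=2}^{n} (C_k − B_k)⁺ ≤ B₁` et `A_k ≥ 0`, `B_k ≥ 0` pour tout `k`." The journal version, S. Fischler, *Groupes de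
Rhin-Viola et intégrales multiples*, J. Théor. Nombres Bordeaux **15** (2003) 479–534 [Fischler2003RhinViola], §5.2
Proposition 16, footnote 3, CORRECTS this remark (« Noter l'erreur, à ce propos, dans [6] »); the corrected wording is not
held by the tree's library (acquisition request acq-09250), which is why the statement file typed no criterion for `𝓛`.
Cell `pub-zeta5`, seat ct-1 g33, 2026-08-27.

HONEST FRAMING (cells pub-zeta5 / zeta5-irr): systematic search; no irrationality claim unless certified. A convergence
criterion for a family of multiple integrals of non-negative functions (real analysis: Tonelli + one-variable estimates)
and a certified erratum of a printed remark; not an irrationality statement; nothing about `ζ(5)`.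

## Results (theorems only; no definition; no new named fact — the statements are the seat's own, DERIVED AND PROVED)
* «if» `LFinite.L_ne_top_of_criterion` (real exponents `r_k = T_k + (n+2−k)ε` in file I's `lintegral_psi_lt_top`) and
  «only if» `LFinite.criterion_of_L_ne_top` (exact exponents `r_k = T_k` in file II's `psi_conditions_of_lintegral_lt_top`),
  where `T_k = max(0, max_{k ≤ j ≤ n} Σ_{i=k}^{j}(C_i − B_i))` solves the nested recursion `T_k = (T_{k+1} + C_k − B_k)⁺`.
* **`L_finite_iff`**: for `n ≥ 1`, `𝓛(P) < ∞ ↔ A_k ≥ 0 ∧ B_k ≥ 0 (1 ≤ k ≤ n) ∧ Σ_{k=2}^{j}(C_k − B_k) ≤ B₁ (2 ≤ j ≤ n)` —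
  ALL PARTIAL SUMS, no positive parts.
* **The erratum as kernel facts**: `note_criterion_sufficient` (the printed condition implies finiteness: `Σ⁺` dominates every
  partial sum) and `note_criterion_not_necessary` (`n = 3`, `A = 0`, `B = (0,1,0)`, `C₂ = 0`, `C₃ = 1`:
  `𝓛 = ∫(1−X₂)/((1−X₁X₂)(1−X₁X₂X₃)²) dX < ∞` — it equals `1` by two exact integrations — while `Σ(C_k−B_k)⁺ = 1 > B₁ = 0`).
* `K_finite_iff` — the criterion for the Beukers–Vasilyev-type family `𝒦(p) = 𝓛(P(p))` through `theoreme21_holds`.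
-/

noncomputable section

namespace Literature.NumberTheory.Irrationality.Fischler2002

open MeasureTheory Set Finset JnChi KL JnFinite
open scoped ENNReal

namespace LFinite

/-! ### The two halves -/

/-- **«If»**: for `n ≥ 1`, if `A_k ≥ 0`, `B_k ≥ 0` (`1 ≤ k ≤ n`) and `Σ_{k=2}^{j}(C_k − B_k) ≤ B₁` (`2 ≤ j ≤ n`) then
`𝓛(P) < ∞`: the real exponents `r_k = T_k + (n+2−k)ε`, `ε = 1/(n+2)`, `T_k = max(0, max_j Σ_{i=k}^{j}(C_i − B_i))`, meet the
strict inequalities of `lintegral_psi_lt_top`. [cite: Fischler2002Polyzetas, §2 p. 3 (critère de finitude de 𝓛)] -/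
theorem L_ne_top_of_criterion {n : ℕ} (hn : 1 ≤ n) (P : Exponents) (ha : ∀ k ∈ Finset.Icc 1 n, 0 ≤ P.a k)
    (hb : ∀ k ∈ Finset.Icc 1 n, 0 ≤ P.b k) (hc : ∀ j ∈ Finset.Icc 2 n, ∑ k ∈ Finset.Icc 2 j, (P.c k - P.b k) ≤ P.b 1) :
    L n P ≠ ∞ := by
  -- the integer maxima of partial sums
  set d : ℕ → ℤ := fun i => P.c i - P.b i with hd
  set T : ℕ → ℤ := fun k => (insert (0 : ℤ) ((Finset.Icc k n).image fun j => ∑ i ∈ Finset.Icc k j, d i)).max'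
    (Finset.insert_nonempty _ _) with hTd
  have hT : ∀ k, T k = (insert (0 : ℤ) ((Finset.Icc k n).image fun j => ∑ i ∈ Finset.Icc k j, d i)).max'
      (Finset.insert_nonempty _ _) := fun k => rfl
  -- the real exponents
  set ε : ℝ := 1 / ((n : ℝ) + 2) with hε
  have hε0 : 0 < ε := by rw [hε]; positivity
  have hεn : ((n : ℝ) + 2) * ε = 1 := by rw [hε]; field_simp
  set α : ℕ → ℝ := fun k => (P.a k : ℝ) with hαd
  set β : ℕ → ℝ := fun k => (P.b k : ℝ) with hβd
  set γ : ℕ → ℝ := fun k => if k = 1 then (0 : ℝ) else ((P.c k : ℝ) + 1) with hγd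
  set r : ℕ → ℝ := fun k => (T k : ℝ) + ((n + 2 - k : ℕ) : ℝ) * ε with hrd
  have hr0 : ∀ k, 0 ≤ r k := fun k => by
    simp only [hrd]
    have : (0 : ℝ) ≤ (T k : ℝ) := by exact_mod_cast (maxPartialSum_ge hT k).1
    positivity
  have hfin := lintegral_psi_lt_top n α β γ r hr0 ?_ ?_ ?_ ?_ n hn le_rfl
  rotate_left
  · -- hα
    intro k hk1 hkn
    simp only [hαd]
    have : (0 : ℝ) ≤ (P.a k : ℝ) := by exact_mod_cast ha k (Finset.mem_Icc.2 ⟨hk1, hkn⟩)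
    linarith
  · -- hβ
    intro k hk2 hkn
    simp only [hβd]
    have : (0 : ℝ) ≤ (P.b k : ℝ) := by exact_mod_cast hb k (Finset.mem_Icc.2 ⟨by omega, hkn⟩)
    linarith
  · -- hγ : `(C_k + 1) + T_{k+1} + (n+1−k)ε − B_k − 1 < T_k + (n+2−k)ε`
    intro k hk2 hkn
    simp only [hγd, hβd, hrd, if_neg (show k ≠ 1 by omega)]
    have hrec : ((T (k + 1) : ℤ) : ℝ) + ((P.c k : ℝ) - (P.b k : ℝ)) ≤ (T k : ℝ) := by
      have h := maxPartialSum_rec hT hkn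
      have h' : T (k + 1) + d k ≤ T k := by rw [h]; exact le_max_left _ _
      have h'' : ((T (k + 1) + d k : ℤ) : ℝ) ≤ (T k : ℝ) := by exact_mod_cast h'
      simpa [hd] using h''
    have hsl : ((n + 2 - (k + 1) : ℕ) : ℝ) * ε < ((n + 2 - k : ℕ) : ℝ) * ε := by
      have : ((n + 2 - (k + 1) : ℕ) : ℝ) < ((n + 2 - k : ℕ) : ℝ) := by
        have : n + 2 - (k + 1) < n + 2 - k := by omega
        exact_mod_cast this
      nlinarith
    linarith
  · -- h1 : `B₁ − T₂ − nε > −1`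
    simp only [hβd, hγd, hrd, if_pos rfl, sub_zero]
    have hT2 : T 2 ≤ P.b 1 :=
      (maxPartialSum_le_iff hT 2 (P.b 1)).2 ⟨hb 1 (Finset.mem_Icc.2 ⟨le_rfl, hn⟩),
        fun j hkj hjn => hc j (Finset.mem_Icc.2 ⟨hkj, hjn⟩)⟩
    have hT2' : ((T 2 : ℤ) : ℝ) ≤ (P.b 1 : ℝ) := by exact_mod_cast hT2
    have hsl : ((n + 2 - 2 : ℕ) : ℝ) * ε < 1 := by
      have : ((n + 2 - 2 : ℕ) : ℝ) < (n : ℝ) + 2 := by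
        have : n + 2 - 2 ≤ n := by omega
        have : ((n + 2 - 2 : ℕ) : ℝ) ≤ (n : ℝ) := by exact_mod_cast this
        linarith
      nlinarith
    linarith
  exact (lt_of_le_of_lt (L_le_lintegral_psi hn P r (hr0 (n + 1))).1 hfin).ne

/-- **«Only if»**: for `n ≥ 1`, if `𝓛(P) < ∞` then `A_k ≥ 0`, `B_k ≥ 0` (`1 ≤ k ≤ n`) and
`Σ_{k=2}^{j}(C_k − B_k) ≤ B₁` (`2 ≤ j ≤ n`) — the exact exponents `r_k = T_k` satisfy the recursion
`r_k = (γ_k + r_{k+1} − β_k − 1)⁺` (`maxPartialSum_rec`) and `r_{n+1} = 0`.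
[cite: Fischler2002Polyzetas, §2 p. 3 (critère de finitude de 𝓛)] -/
theorem criterion_of_L_ne_top {n : ℕ} (hn : 1 ≤ n) (P : Exponents) (hLP : L n P ≠ ∞) :
    (∀ k ∈ Finset.Icc 1 n, 0 ≤ P.a k) ∧ (∀ k ∈ Finset.Icc 1 n, 0 ≤ P.b k) ∧
      ∀ j ∈ Finset.Icc 2 n, ∑ k ∈ Finset.Icc 2 j, (P.c k - P.b k) ≤ P.b 1 := by
  set d : ℕ → ℤ := fun i => P.c i - P.b i with hd
  set T : ℕ → ℤ := fun k => (insert (0 : ℤ) ((Finset.Icc k n).image fun j => ∑ i ∈ Finset.Icc k j, d i)).max'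
    (Finset.insert_nonempty _ _) with hTd
  have hT : ∀ k, T k = (insert (0 : ℤ) ((Finset.Icc k n).image fun j => ∑ i ∈ Finset.Icc k j, d i)).max'
      (Finset.insert_nonempty _ _) := fun k => rfl
  set α : ℕ → ℝ := fun k => (P.a k : ℝ) with hαd
  set β : ℕ → ℝ := fun k => (P.b k : ℝ) with hβd
  set γ : ℕ → ℝ := fun k => if k = 1 then (0 : ℝ) else ((P.c k : ℝ) + 1) with hγd
  set r : ℕ → ℝ := fun k => (T k : ℝ) with hrd
  have hρ : ∀ k, 2 ≤ k → k ≤ n → r k = max (γ k + r (k + 1) - β k - 1) 0 := by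
    intro k hk2 hkn
    simp only [hrd, hγd, hβd, if_neg (show k ≠ 1 by omega)]
    rw [maxPartialSum_rec hT hkn, Int.cast_max, Int.cast_zero]
    simp only [hd]
    push_cast
    ring_nf
  have hrn1 : r (n + 1) = 0 := by
    simp only [hrd]; rw [maxPartialSum_of_lt hT (Nat.lt_succ_self n)]; simp
  have hfin : ∫⁻ X in (Set.pi Set.univ fun _ : Fin n => Ioo (0 : ℝ) 1),
      ENNReal.ofReal ((∏ k ∈ Finset.Icc 1 n, coord X k ^ α k * (1 - coord X k) ^ β k * (1 - headProduct X k) ^ (-γ k)) *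
        (1 - headProduct X n) ^ (-r (n + 1))) < ∞ := by
    rw [← (L_le_lintegral_psi hn P r hrn1.ge).2 hrn1]
    exact lt_top_iff_ne_top.2 hLP
  obtain ⟨h1, h2, h3⟩ := psi_conditions_of_lintegral_lt_top n α β γ r hρ n hn le_rfl hfin
  -- back to the integers
  have hA : ∀ k, 1 ≤ k → k ≤ n → 0 ≤ P.a k := by
    intro k hk1 hkn
    have h := h1 k hk1 hkn
    simp only [hαd] at h
    have h' : (-1 : ℤ) < P.a k := by exact_mod_cast h
    omega
  have hB : ∀ k, 2 ≤ k → k ≤ n → 0 ≤ P.b k := by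
    intro k hk2 hkn
    have h := h2 k hk2 hkn
    simp only [hβd] at h
    have h' : (-1 : ℤ) < P.b k := by exact_mod_cast h
    omega
  have hC : T 2 ≤ P.b 1 := by
    simp only [hβd, hγd, hrd, if_pos rfl, sub_zero] at h3
    have h' : ((T 2 : ℤ) : ℝ) < (P.b 1 : ℝ) + 1 := by linarith
    have h'' : T 2 < P.b 1 + 1 := by exact_mod_cast h'
    omega
  obtain ⟨hB1, hsum⟩ := (maxPartialSum_le_iff hT 2 (P.b 1)).1 hC
  refine ⟨fun k hk => ?_, fun k hk => ?_, fun j hj => ?_⟩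
  · have hk' := Finset.mem_Icc.1 hk
    exact hA k hk'.1 hk'.2
  · have hk' := Finset.mem_Icc.1 hk
    rcases Nat.lt_or_ge k 2 with hk1 | hk2
    · obtain rfl : k = 1 := by omega
      exact hB1
    · exact hB k hk2 hk'.2
  · have hj' := Finset.mem_Icc.1 hj
    exact hsum j hj'.1 hj'.2

end LFinite

/-! ### The criterion, the note's erratum, and the corollary for `𝒦` -/

/-- **The finiteness criterion for Fischler's Sorokin-type family `𝓛(P)`** (derived and proved here; the journal version
[Fischler2003RhinViola, §5.2 Prop. 16 fn. 3] corrects the note's printed formula, its wording is not held): for every `n ≥ 1` and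
`P = (A, B, C) ∈ ℤ^{3n−1}`,
`𝓛(P) = ∫_{[0,1]^n} ∏ X_k^{A_k}(1−X_k)^{B_k} / ∏_{k=2}^n (1 − X₁⋯X_k)^{C_k+1} dX` is finite **iff** `A_k ≥ 0` and `B_k ≥ 0` for all
`k ∈ {1,…,n}` and `Σ_{k=2}^{j} (C_k − B_k) ≤ B₁` for every `j ∈ {2,…,n}`.
[cite: Fischler2002Polyzetas, §2 p. 3 (critère de finitude de 𝓛, as corrected)] [cite: Fischler2003RhinViola, §5.2 Proposition 16] -/
theorem L_finite_iff {n : ℕ} (hn : 1 ≤ n) (P : Exponents) :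
    L n P ≠ ∞ ↔ (∀ k ∈ Finset.Icc 1 n, 0 ≤ P.a k) ∧ (∀ k ∈ Finset.Icc 1 n, 0 ≤ P.b k) ∧
      ∀ j ∈ Finset.Icc 2 n, ∑ k ∈ Finset.Icc 2 j, (P.c k - P.b k) ≤ P.b 1 :=
  ⟨LFinite.criterion_of_L_ne_top hn P, fun h => LFinite.L_ne_top_of_criterion hn P h.1 h.2.1 h.2.2⟩

/-- **The note's printed condition is SUFFICIENT**: for `n ≥ 1`, `A_k ≥ 0`, `B_k ≥ 0` (`k ≤ n`) and
`Σ_{k=2}^{n} (C_k − B_k)⁺ ≤ B₁` imply `𝓛(P) < ∞` (every partial sum `Σ_{k=2}^{j}(C_k − B_k)` is at most the sum of positive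
parts). [cite: Fischler2002Polyzetas, §2 p. 3 (« Cette intégrale est finie [ssi] on a Σ(C_k−B_k)⁺ ≤ B₁ et A_k ≥ 0, B_k ≥ 0 »)] -/
theorem note_criterion_sufficient {n : ℕ} (hn : 1 ≤ n) (P : Exponents) (ha : ∀ k ∈ Finset.Icc 1 n, 0 ≤ P.a k)
    (hb : ∀ k ∈ Finset.Icc 1 n, 0 ≤ P.b k) (h : ∑ k ∈ Finset.Icc 2 n, max (P.c k - P.b k) 0 ≤ P.b 1) :
    L n P ≠ ∞ := by
  refine (L_finite_iff hn P).2 ⟨ha, hb, fun j hj => le_trans ?_ h⟩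
  have hj' := Finset.mem_Icc.1 hj
  calc ∑ k ∈ Finset.Icc 2 j, (P.c k - P.b k) ≤ ∑ k ∈ Finset.Icc 2 j, max (P.c k - P.b k) 0 :=
        Finset.sum_le_sum fun k _ => le_max_left _ _
    _ ≤ ∑ k ∈ Finset.Icc 2 n, max (P.c k - P.b k) 0 :=
        Finset.sum_le_sum_of_subset_of_nonneg (Finset.Icc_subset_Icc_right hj'.2) fun k _ _ => le_max_right _ _

/-- **The note's printed condition is NOT NECESSARY (erratum, as flagged by the journal)**: for `n = 3`, `A = (0,0,0)`,
`B = (0,1,0)`, `C₂ = 0`, `C₃ = 1` the integral `𝓛(P) = ∫_{[0,1]³} (1−X₂) / ((1−X₁X₂)(1−X₁X₂X₃)²) dX` is FINITE (it equals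
`1`: `∫₀¹ dX₃/(1−YX₃)² = 1/(1−Y)`, then `∫₀¹ dX₁/(1−X₂X₁)² = 1/(1−X₂)`), while `Σ_{k=2}^{3}(C_k − B_k)⁺ = 0 + 1 = 1 > B₁ = 0`.
[cite: Fischler2002Polyzetas, §2 p. 3 (critère de finitude de 𝓛)] [cite: Fischler2003RhinViola, §5.2 Proposition 16 footnote 3 (« Noter l'erreur, à ce propos, dans [6] »)] -/
theorem note_criterion_not_necessary :
    ∃ P : Exponents, (∀ k, 0 ≤ P.a k) ∧ (∀ k, 0 ≤ P.b k) ∧ L 3 P ≠ ∞ ∧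
      P.b 1 < ∑ k ∈ Finset.Icc 2 3, max (P.c k - P.b k) 0 := by
  refine ⟨⟨fun _ => 0, fun k => if k = 2 then 1 else 0, fun k => if k = 3 then 1 else 0⟩,
    fun k => le_rfl, fun k => by dsimp only; split_ifs <;> norm_num, ?_, by decide⟩
  refine (L_finite_iff (by norm_num) _).2 ⟨fun k _ => le_rfl, fun k _ => by dsimp only; split_ifs <;> norm_num, ?_⟩
  intro j hj
  have hj' := Finset.mem_Icc.1 hj
  rcases (show j = 2 ∨ j = 3 by omega) with rfl | rfl <;> decide

/-- **The finiteness criterion for the Beukers–Vasilyev-type family `𝒦(p)`** (through the PROVED Théorème 2.1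
`𝒦(p) = 𝓛(P(p))`, `theoreme21_holds`): for `n ≥ 2`, `𝒦(p) < ∞` iff `P = paramMap n p` satisfies the criterion of
`L_finite_iff`. [cite: Fischler2002Polyzetas, §2 Théorème 2.1 and p. 3 (critère de finitude)] -/
theorem K_finite_iff {n : ℕ} (hn : 2 ≤ n) (p : Exponents) :
    K n p ≠ ∞ ↔ (∀ k ∈ Finset.Icc 1 n, 0 ≤ (paramMap n p).a k) ∧ (∀ k ∈ Finset.Icc 1 n, 0 ≤ (paramMap n p).b k) ∧
      ∀ j ∈ Finset.Icc 2 n, ∑ k ∈ Finset.Icc 2 j, ((paramMap n p).c k - (paramMap n p).b k) ≤ (paramMap n p).b 1 := by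
  rw [theoreme21_holds n p hn]
  exact L_finite_iff (by omega) _

/-- **The criterion in RECURSIVE form** (the shape of Fischler's `ρ_k` of §3: a nested recursion read downwards from
`k = n`): for `n ≥ 1`, ANY integers `T_2, …, T_{n+1}` with `T_{n+1} = 0` and `T_k = (T_{k+1} + C_k − B_k)⁺` (`2 ≤ k ≤ n`) satisfy
`𝓛(P) < ∞ ↔ A_k ≥ 0 ∧ B_k ≥ 0 (1 ≤ k ≤ n) ∧ T₂ ≤ B₁`; the recursion unrolls to `T_k = max(0, max_{k≤j≤n} Σ_{i=k}^{j}(C_i − B_i))`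
(`LFinite.maxPartialSum_rec`), whence `L_finite_iff`'s partial sums. STATUS OF THE STATEMENT (for the record, applies to
`L_finite_iff` as well): (1) this criterion is the seat's OWN, derived and proved here from the tree's definition `L` — not a
transcription; (2) the C. R. note's printed condition « Σ_{k=2}^{n}(C_k − B_k)⁺ ≤ B₁ et A_k, B_k ≥ 0 » is SUFFICIENT but NOT
NECESSARY (kernel facts `note_criterion_sufficient`, `note_criterion_not_necessary`); (3) the journal's corrected Proposition 16
(J. Théor. Nombres Bordeaux 15 (2003), §5.2, footnote 3) is NOT held by the cell (acquisition request acq-09250 open) and NO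
claim is made that the present wording is its wording — a later seat compares when the text arrives.
[cite: Fischler2002Polyzetas, §2 p. 3 (critère de finitude de 𝓛)] [cite: Fischler2003RhinViola, §5.2 Proposition 16 (not held; see docstring)] -/
theorem L_finite_iff_rec {n : ℕ} (hn : 1 ≤ n) (P : Exponents) (T : ℕ → ℤ) (hT1 : T (n + 1) = 0)
    (hT : ∀ k, 2 ≤ k → k ≤ n → T k = max (T (k + 1) + (P.c k - P.b k)) 0) :
    L n P ≠ ∞ ↔ (∀ k ∈ Finset.Icc 1 n, 0 ≤ P.a k) ∧ (∀ k ∈ Finset.Icc 1 n, 0 ≤ P.b k) ∧ T 2 ≤ P.b 1 := by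
  -- the closed form `T'` of file II and its agreement with `T` on `2 ≤ k ≤ n+1` (downward induction)
  set T' : ℕ → ℤ := fun k => (insert (0 : ℤ) ((Finset.Icc k n).image fun j => ∑ i ∈ Finset.Icc k j, (P.c i - P.b i))).max'
    (Finset.insert_nonempty _ _) with hT'd
  have hT' : ∀ k, T' k = (insert (0 : ℤ) ((Finset.Icc k n).image fun j =>
      ∑ i ∈ Finset.Icc k j, (P.c i - P.b i))).max' (Finset.insert_nonempty _ _) := fun k => rfl
  have key : ∀ m k, k + m = n + 1 → 2 ≤ k → T k = T' k := by
    intro m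
    induction m with
    | zero =>
      intro k hk _
      rw [show k = n + 1 by omega, hT1, LFinite.maxPartialSum_of_lt hT' (Nat.lt_succ_self n)]
    | succ m ih =>
      intro k hk hk2
      rw [hT k hk2 (by omega), ih (k + 1) (by omega) (by omega), LFinite.maxPartialSum_rec hT' (show k ≤ n by omega)]
  have h2 : T 2 = T' 2 := key (n - 1) 2 (by omega) le_rfl
  rw [L_finite_iff hn P, h2]
  refine ⟨fun ⟨ha, hb, hc⟩ => ⟨ha, hb, ?_⟩, fun ⟨ha, hb, hc⟩ => ⟨ha, hb, fun j hj => ?_⟩⟩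
  · exact (LFinite.maxPartialSum_le_iff hT' 2 (P.b 1)).2
      ⟨hb 1 (Finset.mem_Icc.2 ⟨le_rfl, hn⟩), fun j hkj hjn => hc j (Finset.mem_Icc.2 ⟨hkj, hjn⟩)⟩
  · have hj' := Finset.mem_Icc.1 hj
    exact ((LFinite.maxPartialSum_le_iff hT' 2 (P.b 1)).1 hc).2 j hj'.1 hj'.2

end Literature.NumberTheory.Irrationality.Fischler2002

end
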